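import Summits.QuantumFields.Balaban3D.Proofs.FibreClash
import Literature.MathematicalPhysics.QuantumFieldTheory.Balaban1983to89.T4ExpWindowSmallField
import Summits.QuantumFields.Balaban3D.Proofs.ProductChartSU2

/-!
# `Summit.QuantumFields.Balaban3D.Proofs.FibreClashWitness` — REGRESSION GUARD for seat p4's FINDING (lane `pub-balaban3d`, STEP-5 exit item
# (b)(iii) of lead batch 30): the event excluded by `FibreClash.ae_small_of_transported_pair` has POSITIVE product-Haar measure whenever the
# (49)-threshold exceeds `4·ε₁(k)` — for every gauge group whose Haar data charges the small balls `{|g − 1| < δ}` and contains an element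
# with `|h − 1|` in the gap (§1–§2, abstract), and concretely for `G = SU(2)` (§3) — so Bound55Std v3's residual pair (χB at `εS`) was
# JOINTLY FALSE, while v4's (χB at `ε₁`) meets no obstruction from this mechanism (§4, the lead's item (b)(ii)).

HONEST FRAMING (lane PLAN.md §0, binding): see `…Proofs.SectAFirstStep`.  [folklore] measure theory on the tree's carriers (`AveragingRT.axialAvg`,
`offBond`/`line_ne_offBond`, `fieldMeasure`, the `SU(n)` instances of `UnitaryModel`, the exp chart of `T4ExpWindowSmallField`); nothing of
[Balaban1985UV3] is asserted.  An evidence file (not filed unless asked).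

THE WITNESS.  `U₀ := 1` except on the bond `b₀ = offBond` (off every averaging line, `d ≥ 2`, standing range), `U₀(b₀) = h` with
`ε₁(k) < |h − 1| < εS/4`; the Haar-open box `N = {U : |U(b)U₀(b)⁻¹ − 1| < δ ∀b}` satisfies, for `4δ ≤ |h−1| − ε₁`, `4|h−1| + 4δ ≤ εS`, `4Lδ < ε₁(k+1)`:
every `U ∈ N` has all plaquettes `< εS` (each bond variable within `δ + |h−1|` of `1`), the plaquette `p₀ ∋ b₀` has `|U(∂p₀) − 1| > |h−1| − 4δ ≥ ε₁(k)`
(non-abelian telescoping through `dist1_conj`), and `Ū = ` the axial transport along lines missing `b₀` has plaquettes `< 4Lδ`; and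
`dU(N) = haar{|g − 1| < δ}^{#bonds} > 0`.
-/

noncomputable section

namespace Summit.QuantumFields.Balaban3D.Proofs.FibreClashWitness

open _root_.MeasureTheory
open Literature.MathematicalPhysics.QuantumFieldTheory.Balaban1983to89
open Literature.MathematicalPhysics.QuantumFieldTheory.Balaban1983to89.AveragingRT (axialAvg pathProd line offBond line_ne_offBond)
open Literature.MathematicalPhysics.QuantumFieldTheory.Balaban1983to89.GaugeField (plaqHol)

/-! ## §1 `dist1` bookkeeping (the interface identities of `GaugeGroup` only) -/

section Dist

variable {G : Type*} [GaugeGroup G]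

/-- `|ab(a′b′)⁻¹ − 1| ≤ |aa′⁻¹ − 1| + |bb′⁻¹ − 1|` (conjugation invariance + subadditivity of `dist1`). [folklore] -/
theorem dist1_mul_mul_inv_le (a b a' b' : G) : dist1 (a * b * (a' * b')⁻¹) ≤ dist1 (a * a'⁻¹) + dist1 (b * b'⁻¹) := by
  have h : a * b * (a' * b')⁻¹ = (a * (b * b'⁻¹) * a⁻¹) * (a * a'⁻¹) := by group
  rw [h]
  calc dist1 ((a * (b * b'⁻¹) * a⁻¹) * (a * a'⁻¹)) ≤ dist1 (a * (b * b'⁻¹) * a⁻¹) + dist1 (a * a'⁻¹) :=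
        GaugeGroup.dist1_mul_le _ _
    _ = dist1 (b * b'⁻¹) + dist1 (a * a'⁻¹) := by rw [GaugeGroup.dist1_conj]
    _ = dist1 (a * a'⁻¹) + dist1 (b * b'⁻¹) := add_comm _ _

/-- `|a⁻¹(a′⁻¹)⁻¹ − 1| = |aa′⁻¹ − 1|`. [folklore] -/
theorem dist1_inv_mul_inv_inv (a a' : G) : dist1 (a⁻¹ * (a'⁻¹)⁻¹) = dist1 (a * a'⁻¹) := by
  have h : a⁻¹ * (a'⁻¹)⁻¹ = a⁻¹ * (a * a'⁻¹)⁻¹ * a⁻¹⁻¹ := by group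
  rw [h, GaugeGroup.dist1_conj, GaugeGroup.dist1_inv]

/-- `|y − 1| ≤ |xy⁻¹ − 1| + |x − 1|`. [folklore] -/
theorem dist1_le_dist1_mul_inv_add' (x y : G) : dist1 y ≤ dist1 (x * y⁻¹) + dist1 x := by
  have h : y = (x * y⁻¹)⁻¹ * x := by group
  conv_lhs => rw [h]
  calc dist1 ((x * y⁻¹)⁻¹ * x) ≤ dist1 (x * y⁻¹)⁻¹ + dist1 x := GaugeGroup.dist1_mul_le _ _
    _ = dist1 (x * y⁻¹) + dist1 x := by rw [GaugeGroup.dist1_inv]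

variable {P : Params} {j : ℕ}

/-- Plaquette variables of two configurations whose bond variables are `δ`-close are `4δ`-close: `|U(∂p)U₀(∂p)⁻¹ − 1| ≤ 4δ`. [folklore] -/
theorem dist1_plaqHol_mul_inv_le (U U₀ : GaugeField P j G) (p : Plaq P j) {δ : ℝ}
    (h : ∀ b, dist1 (U b * (U₀ b)⁻¹) ≤ δ) : dist1 (plaqHol U p * (plaqHol U₀ p)⁻¹) ≤ 4 * δ := by
  unfold plaqHol
  set e1 : PBond P j := ⟨p.src, p.μ⟩
  set e2 : PBond P j := ⟨p.src.shift p.μ, p.ν⟩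
  set e3 : PBond P j := ⟨p.src.shift p.ν, p.μ⟩
  set e4 : PBond P j := ⟨p.src, p.ν⟩
  calc dist1 (U e1 * U e2 * (U e3)⁻¹ * (U e4)⁻¹ * (U₀ e1 * U₀ e2 * (U₀ e3)⁻¹ * (U₀ e4)⁻¹)⁻¹)
      ≤ dist1 (U e1 * U e2 * (U e3)⁻¹ * (U₀ e1 * U₀ e2 * (U₀ e3)⁻¹)⁻¹) + dist1 ((U e4)⁻¹ * ((U₀ e4)⁻¹)⁻¹) :=
        dist1_mul_mul_inv_le _ _ _ _
    _ ≤ (dist1 (U e1 * U e2 * (U₀ e1 * U₀ e2)⁻¹) + dist1 ((U e3)⁻¹ * ((U₀ e3)⁻¹)⁻¹)) + dist1 ((U e4)⁻¹ * ((U₀ e4)⁻¹)⁻¹) :=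
        add_le_add (dist1_mul_mul_inv_le _ _ _ _) le_rfl
    _ ≤ ((dist1 (U e1 * (U₀ e1)⁻¹) + dist1 (U e2 * (U₀ e2)⁻¹)) + dist1 ((U e3)⁻¹ * ((U₀ e3)⁻¹)⁻¹)) +
          dist1 ((U e4)⁻¹ * ((U₀ e4)⁻¹)⁻¹) :=
        add_le_add (add_le_add (dist1_mul_mul_inv_le _ _ _ _) le_rfl) le_rfl
    _ = dist1 (U e1 * (U₀ e1)⁻¹) + dist1 (U e2 * (U₀ e2)⁻¹) + dist1 (U e3 * (U₀ e3)⁻¹) + dist1 (U e4 * (U₀ e4)⁻¹) := by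
        rw [dist1_inv_mul_inv_inv, dist1_inv_mul_inv_inv]
    _ ≤ δ + δ + δ + δ := by gcongr <;> exact h _
    _ = 4 * δ := by ring

/-- A plaquette variable is within `Σ_{b∈∂p} |U(b) − 1|` of `1`: if every bond variable is `δ`-close to `1`, `|U(∂p) − 1| ≤ 4δ`. [folklore] -/
theorem dist1_plaqHol_le (U : GaugeField P j G) (p : Plaq P j) {δ : ℝ} (h : ∀ b, dist1 (U b) ≤ δ) :
    dist1 (plaqHol U p) ≤ 4 * δ := by
  have h1 : ∀ b, dist1 (U b * ((1 : GaugeField P j G) b)⁻¹) ≤ δ := fun b => by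
    show dist1 (U b * (1 : G)⁻¹) ≤ δ
    rw [inv_one, mul_one]; exact h b
  have h2 := dist1_plaqHol_mul_inv_le U 1 p h1
  have h3 : plaqHol (1 : GaugeField P j G) p = 1 := by
    show (1 : G) * 1 * (1 : G)⁻¹ * (1 : G)⁻¹ = 1
    group
  rwa [h3, inv_one, mul_one] at h2

/-- The axial transports along a line whose bond variables are `δ`-close to `1` are `nδ`-close to `1`. [folklore] -/
theorem dist1_pathProd_le (U : GaugeField P j G) (c : PBond P (j + 1)) {δ : ℝ} (h : ∀ t, dist1 (U (line c t)) ≤ δ) :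
    ∀ n, dist1 (pathProd U c n) ≤ n * δ
  | 0 => by simp [pathProd, GaugeGroup.dist1_one]
  | n + 1 => by
    show dist1 (pathProd U c n * U (line c n)) ≤ (n + 1 : ℕ) * δ
    calc dist1 (pathProd U c n * U (line c n)) ≤ dist1 (pathProd U c n) + dist1 (U (line c n)) := GaugeGroup.dist1_mul_le _ _
      _ ≤ n * δ + δ := add_le_add (dist1_pathProd_le U c h n) (h n)
      _ = (n + 1 : ℕ) * δ := by push_cast; ring

end Dist

/-! ## §2 The excluded event has positive measure (abstract group; two hypotheses on the Haar data and one gap element) -/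

section Positivity

variable {P : Params} {j : ℕ} {G : Type*} [GaugeGroup G] [MeasurableSpace G] [HaarData G] [RegularGaugeGroup G]

open Classical in
/-- THE WITNESS CONFIGURATION: `1` on every bond except `b₀`, where it is `h`. [folklore] -/
def bump (b₀ : PBond P j) (h : G) : GaugeField P j G := fun b => if b = b₀ then h else 1

omit [MeasurableSpace G] [HaarData G] [RegularGaugeGroup G] in
/-- Every bond variable of the witness is within `|h − 1|` of `1`. [folklore] -/
theorem dist1_bump_le (b₀ : PBond P j) (h : G) (b : PBond P j) : dist1 (bump b₀ h b) ≤ dist1 h := by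
  unfold bump; split_ifs
  · exact le_rfl
  · rw [GaugeGroup.dist1_one]; exact GaugeGroup.dist1_nonneg h

omit [MeasurableSpace G] [HaarData G] [RegularGaugeGroup G] in
/-- Off `b₀` the witness is `1`. [folklore] -/
theorem bump_ne (b₀ : PBond P j) (h : G) {b : PBond P j} (hb : b ≠ b₀) : bump b₀ h b = 1 := by
  unfold bump; rw [if_neg hb]

omit [MeasurableSpace G] [HaarData G] [RegularGaugeGroup G] in
/-- The witness at the OFF-LINE bond `offBond` is `1` on every bond of every averaging line (standing range, `d ≥ 2`). [folklore] -/
theorem bump_offBond_line (hj : j + 1 ≤ P.m + P.K) (hd : 2 ≤ P.d) (h : G) (c : PBond P (j + 1)) {t : ℕ} (ht : t < P.L) :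
    bump (offBond P hd j) h (line c t) = 1 := by
  unfold bump; rw [if_neg (line_ne_offBond hj hd c ht)]

omit [MeasurableSpace G] [HaarData G] [RegularGaugeGroup G] in
/-- The plaquette `p₀ = (0; e_0, e_1)` through the off-line bond `b₀ = (0, e_0)` has witness plaquette variable EXACTLY `h`. [folklore] -/
theorem plaqHol_bump_offBond (hd : 2 ≤ P.d) (h : G) :
    plaqHol (bump (offBond P hd j) h) ⟨fun _ => 0, ⟨0, by omega⟩, ⟨1, by omega⟩, by simp [Fin.lt_def]⟩ = h := by
  classical
  have h10 : (⟨1, by omega⟩ : Fin P.d) ≠ ⟨0, by omega⟩ := by simp [Fin.ext_iff]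
  have hshift : Site.shift (fun _ : Fin P.d => (0 : ZMod (P.sitesPerDir j))) ⟨1, by omega⟩ ≠ fun _ => 0 := by
    intro H
    have := congr_fun H ⟨1, by omega⟩
    simp [Site.shift] at this
  have hne2 : (⟨Site.shift (fun _ : Fin P.d => (0 : ZMod (P.sitesPerDir j))) ⟨0, by omega⟩, ⟨1, by omega⟩⟩ : PBond P j)
      ≠ offBond P hd j := fun H => h10 (congrArg PBond.dir H)
  have hne3 : (⟨Site.shift (fun _ : Fin P.d => (0 : ZMod (P.sitesPerDir j))) ⟨1, by omega⟩, ⟨0, by omega⟩⟩ : PBond P j)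
      ≠ offBond P hd j := fun H => hshift (congrArg PBond.src H)
  have hne4 : (⟨fun _ : Fin P.d => (0 : ZMod (P.sitesPerDir j)), ⟨1, by omega⟩⟩ : PBond P j) ≠ offBond P hd j :=
    fun H => h10 (congrArg PBond.dir H)
  have hb₀ : bump (offBond P hd j) h (offBond P hd j) = h := by unfold bump; rw [if_pos rfl]
  have hb2 := bump_ne (P := P) (j := j) (offBond P hd j) h hne2
  have hb3 := bump_ne (P := P) (j := j) (offBond P hd j) h hne3
  have hb4 := bump_ne (P := P) (j := j) (offBond P hd j) h hne4
  unfold plaqHol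
  rw [show (⟨fun _ : Fin P.d => (0 : ZMod (P.sitesPerDir j)), ⟨0, by omega⟩⟩ : PBond P j) = offBond P hd j from rfl, hb₀, hb2, hb3,
    hb4]
  group

omit [MeasurableSpace G] [HaarData G] [RegularGaugeGroup G] in
/-- **THE BOX AROUND THE WITNESS LIES IN THE EXCLUDED EVENT.**  `d ≥ 2`, standing range; `h` with `a₁ + 4δ ≤ |h − 1|`, `4|h − 1| + 4δ < aS`,
`4Lδ < a′`: every `U` with `|U(b)·bump(b)⁻¹ − 1| < δ ∀b` has all plaquettes `< aS`, `Ū` with all plaquettes `< a′`, and NOT all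
plaquettes `< a₁`. [folklore] -/
theorem box_subset (hj : j + 1 ≤ P.m + P.K) (hd : 2 ≤ P.d) (h : G) {a₁ aS a' δ : ℝ}
    (h1 : a₁ + 4 * δ ≤ dist1 h) (h2 : 4 * dist1 h + 4 * δ < aS) (h3 : 4 * (P.L : ℝ) * δ < a')
    (U : GaugeField P j G) (hU : ∀ b, dist1 (U b * (bump (offBond P hd j) h b)⁻¹) < δ) :
    PlaqSmall aS U ∧ PlaqSmall a' (axialAvg U) ∧ ¬ PlaqSmall a₁ U := by
  set U₀ := bump (offBond P hd j) h with hU₀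
  refine ⟨fun p => ?_, fun q => ?_, fun hsm => ?_⟩
  · -- all plaquettes below `aS`: each bond variable within `δ + |h−1|` of `1`
    have hb : ∀ b, dist1 (U b) ≤ δ + dist1 h := fun b => by
      have hx : dist1 (U b) ≤ dist1 (U b * (U₀ b)⁻¹) + dist1 (U₀ b) := by
        have e : U b = U b * (U₀ b)⁻¹ * U₀ b := by group
        conv_lhs => rw [e]
        exact GaugeGroup.dist1_mul_le _ _
      exact hx.trans (add_le_add (hU b).le (dist1_bump_le _ h b))
    have := dist1_plaqHol_le U p hb
    linarith
  · -- the averaged field: lines miss `b₀`, so every line bond variable is `δ`-close to `1`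
    have hline : ∀ (c : PBond P (j + 1)) (t : ℕ), t < P.L → dist1 (U (line c t)) ≤ δ := fun c t ht => by
      have := hU (line c t)
      rw [hU₀, bump_offBond_line hj hd h c ht, inv_one, mul_one] at this
      exact this.le
    have havg : ∀ c : PBond P (j + 1), dist1 (axialAvg U c) ≤ (P.L : ℝ) * δ := fun c => by
      -- transports along the first `n ≤ L` bonds
      have key : ∀ n, n ≤ P.L → dist1 (pathProd U c n) ≤ n * δ := by
        intro n hn
        induction n with
        | zero => simp [pathProd, GaugeGroup.dist1_one]
        | succ n ih =>
          show dist1 (pathProd U c n * U (line c n)) ≤ (n + 1 : ℕ) * δ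
          calc dist1 (pathProd U c n * U (line c n)) ≤ dist1 (pathProd U c n) + dist1 (U (line c n)) :=
                GaugeGroup.dist1_mul_le _ _
            _ ≤ n * δ + δ := add_le_add (ih (by omega)) (hline c n (by omega))
            _ = (n + 1 : ℕ) * δ := by push_cast; ring
      exact key P.L le_rfl
    have := dist1_plaqHol_le (axialAvg U) q havg
    linarith
  · -- the plaquette through `b₀` is NOT `a₁`-small
    set p₀ : Plaq P j := ⟨fun _ => 0, ⟨0, by omega⟩, ⟨1, by omega⟩, by simp [Fin.lt_def]⟩ with hp₀
    have hex : plaqHol U₀ p₀ = h := plaqHol_bump_offBond hd h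
    have hclose : dist1 (plaqHol U p₀ * (plaqHol U₀ p₀)⁻¹) ≤ 4 * δ :=
      dist1_plaqHol_mul_inv_le U U₀ p₀ fun b => (hU b).le
    have hlow := dist1_le_dist1_mul_inv_add' (plaqHol U p₀) (plaqHol U₀ p₀)
    rw [hex] at hlow hclose
    have hsm₀ := hsm p₀
    linarith

/-- The Haar-open box around a configuration is a product set of FULL product-Haar measure `haar{|g − 1| < δ}^{#bonds}` (right invariance,
factorwise). [folklore] -/
theorem fieldMeasure_box (U₀ : GaugeField P j G) (δ : ℝ) :
    fieldMeasure P j G {U | ∀ b, dist1 (U b * (U₀ b)⁻¹) < δ} =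
      (HaarData.haar {g : G | dist1 g < δ}) ^ Fintype.card (PBond P j) := by
  have hB : MeasurableSet {g : G | dist1 g < δ} := measurableSet_lt RegularGaugeGroup.measurable_dist1 measurable_const
  have hset : {U : GaugeField P j G | ∀ b, dist1 (U b * (U₀ b)⁻¹) < δ} =
      Set.univ.pi fun b => (fun g : G => g * (U₀ b)⁻¹) ⁻¹' {g : G | dist1 g < δ} := by
    ext U; exact ⟨fun H b _ => H b, fun H b => H b (Set.mem_univ b)⟩
  have hfac : ∀ b : PBond P j, (HaarData.haar : Measure G) ((fun g : G => g * (U₀ b)⁻¹) ⁻¹' {g : G | dist1 g < δ}) =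
      HaarData.haar {g : G | dist1 g < δ} := fun b => by
    rw [← Measure.map_apply (measurable_mul_const _) hB, HaarData.map_mul_right]
  have key : (Measure.pi fun _ : PBond P j => (HaarData.haar : Measure G))
      (Set.univ.pi fun b => (fun g : G => g * (U₀ b)⁻¹) ⁻¹' {g : G | dist1 g < δ}) =
      ∏ b : PBond P j, (HaarData.haar : Measure G) ((fun g : G => g * (U₀ b)⁻¹) ⁻¹' {g : G | dist1 g < δ}) :=
    Measure.pi_pi _ _
  rw [hset]
  refine key.trans ?_
  simp only [hfac, Finset.prod_const, Finset.card_univ]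

/-- **POSITIVITY ⇒ THE a.e. IMPLICATION FAILS.**  If the Haar data charges the ball `{|g − 1| < δ}` and a gap element `h` exists (hypotheses as in
`box_subset`; `δ > 0` is implied by the charge hypothesis), then «all plaquettes `< aS` ∧ all plaquettes of `Ū` `< a′` ⇒ all plaquettes `< a₁`» does NOT hold dU-a.e. [folklore] -/
theorem not_ae_small (hj : j + 1 ≤ P.m + P.K) (hd : 2 ≤ P.d) (h : G) {a₁ aS a' δ : ℝ}
    (h1 : a₁ + 4 * δ ≤ dist1 h) (h2 : 4 * dist1 h + 4 * δ < aS) (h3 : 4 * (P.L : ℝ) * δ < a')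
    (hpos : (HaarData.haar : Measure G) {g : G | dist1 g < δ} ≠ 0) :
    ¬ (∀ᵐ U ∂(fieldMeasure P j G), PlaqSmall aS U → PlaqSmall a' (axialAvg U) → PlaqSmall a₁ U) := by
  intro hae
  rw [ae_iff] at hae
  have hsub : {U : GaugeField P j G | ∀ b, dist1 (U b * (bump (offBond P hd j) h b)⁻¹) < δ} ⊆
      {U | ¬ (PlaqSmall aS U → PlaqSmall a' (axialAvg U) → PlaqSmall a₁ U)} := fun U hU => by
    obtain ⟨hS, hA, hN⟩ := box_subset hj hd h h1 h2 h3 U hU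
    exact fun H => hN (H hS hA)
  have h0 := measure_mono_null hsub hae
  rw [fieldMeasure_box] at h0
  exact pow_ne_zero _ hpos h0

end Positivity

/-! ## §3 The two hypotheses for `G = SU(2)` (normalized Haar measure; the exp chart of the 4D cell) -/

section SU2

open Literature.MathematicalPhysics.QuantumLattice (fundamentalRep continuous_fundamentalRep)
open Summit.QuantumFields.Balaban3D.Proofs.ProductChartSU2 (SU2)
open Literature.MathematicalPhysics.QuantumFieldTheory.Balaban1983to89.T4HaarSU2ExpChart (expPoint)
open Literature.MathematicalPhysics.QuantumFieldTheory.Balaban1983to89.T4ExpWindowSmallField (dist1_expPoint_eq)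

/-- The normalized Haar measure of `SU(2)` charges every ball `{|g − 1| < δ}`, `δ > 0` (Haar measures are positive on non-empty open sets). [folklore] -/
theorem haar_ball_ne_zero_su2 {δ : ℝ} (hδ : 0 < δ) : (HaarData.haar : Measure SU2) {g : SU2 | dist1 g < δ} ≠ 0 := by
  haveI : LocallyCompactSpace SU2 :=
    Literature.RepresentationTheory.CompactGroups.CompactGroup.locallyCompactSpace_of_compactSpace_group
  have hcont : Continuous (dist1 : SU2 → ℝ) := UnitaryModel.continuous_opDist1.comp (continuous_fundamentalRep (Fin 2))
  have hopen : IsOpen {g : SU2 | dist1 g < δ} := isOpen_lt hcont continuous_const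
  have hne : ({g : SU2 | dist1 g < δ}).Nonempty := ⟨1, by simpa [GaugeGroup.dist1_one] using hδ⟩
  show (Measure.haarMeasure (⊤ : TopologicalSpace.PositiveCompacts SU2)) {g : SU2 | dist1 g < δ} ≠ 0
  exact hopen.measure_ne_zero _ hne

/-- `SU(2)` has an element at ANY prescribed distance `t ∈ [0, 2]` from `1`: `|exp(ι·2arcsin(t/2)·e₀) − 1| = 2|sin(arcsin(t/2))| = t`. [folklore] -/
theorem exists_dist1_eq_su2 {t : ℝ} (ht0 : 0 ≤ t) (ht2 : t ≤ 2) : ∃ h : SU2, dist1 h = t := by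
  have har : 0 ≤ 2 * Real.arcsin (t / 2) := mul_nonneg (by norm_num) (Real.arcsin_nonneg.mpr (by linarith))
  obtain ⟨x, hx⟩ := exists_norm_eq (EuclideanSpace ℝ (Fin 3)) har
  refine ⟨expPoint x, ?_⟩
  rw [dist1_expPoint_eq, hx, show 2 * Real.arcsin (t / 2) / 2 = Real.arcsin (t / 2) by ring,
    Real.sin_arcsin (by linarith) (by linarith), abs_of_nonneg (by linarith)]
  ring

/-- **SU(2) WITNESS**: for thresholds with `0 ≤ a₁`, `4a₁ < aS ≤ 4`, `0 < a′` (the lane's `ε₁(k) = g_kp(g_k)`, `εS_k = 2L²g_{k−1}p(g_{k−1})`,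
`ε₁(k+1)` along the coupling window), standing range, the a.e. implication «all plaquettes `< aS` ∧ `Ū` all `< a′` ⇒ all `< a₁`» is FALSE
for `SU(2)`-valued fields and the axial average. [folklore] -/
theorem not_ae_small_su2 {P : Params} {j : ℕ} (hj : j + 1 ≤ P.m + P.K) (hd : 2 ≤ P.d) {a₁ aS a' : ℝ}
    (h0 : 0 ≤ a₁) (h1 : 4 * a₁ < aS) (h2 : aS ≤ 4) (h3 : 0 < a') :
    ¬ (∀ᵐ U ∂(fieldMeasure P j SU2), PlaqSmall aS U → PlaqSmall a' (axialAvg U) → PlaqSmall a₁ U) := by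
  -- gap element at distance t = (4a₁ + aS)/8 and box radius δ
  have hL : (0 : ℝ) < P.L := by exact_mod_cast P.L_pos
  obtain ⟨h, hh⟩ := exists_dist1_eq_su2 (t := (4 * a₁ + aS) / 8) (by linarith) (by linarith)
  set δ : ℝ := min ((aS - 4 * a₁) / 32) (a' / (8 * P.L)) with hδ
  have hδ1 : δ ≤ (aS - 4 * a₁) / 32 := min_le_left _ _
  have hδ2 : δ ≤ a' / (8 * P.L) := min_le_right _ _
  have hδ0 : 0 < δ := lt_min (by linarith) (by positivity)
  refine not_ae_small hj hd h ?_ ?_ ?_ (haar_ball_ne_zero_su2 hδ0)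
  · rw [hh]; linarith
  · rw [hh]; nlinarith
  · have : 4 * (P.L : ℝ) * δ ≤ 4 * P.L * (a' / (8 * P.L)) := by gcongr
    have h' : 4 * (P.L : ℝ) * (a' / (8 * P.L)) = a' / 2 := by field_simp; ring
    linarith

end SU2

/-! ## §4 The lane: v3's pair was FALSE at `G = SU(2)` for the standard external inputs; v4's pair passes the mechanism -/

section Lane

open Literature.MathematicalPhysics.QuantumFieldTheory.Balaban1983to89.AveragingRT (rnTransport stdAvg)
open Literature.MathematicalPhysics.QuantumFieldTheory.Balaban1983to89.B10SectAGathering (StepPieces)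
open Literature.MathematicalPhysics.QuantumFieldTheory.Balaban1985CMP102
open Literature.MathematicalPhysics.QuantumFieldTheory.Balaban1985CMP102.Setting
open Summit.QuantumFields.Balaban3D.Carriers
open Summit.QuantumFields.Balaban3D.Proofs.Bound55Masses
open Summit.QuantumFields.Balaban3D.Proofs.Bound55Std
open Summit.QuantumFields.Balaban3D.Proofs.FibreClash
open Summit.QuantumFields.Balaban3D.Proofs.ProductChartSU2 (SU2)

variable {L : ℕ} {S : Scales L}

/-- In the standing range the lane's standard averaging IS the axial average. [folklore] -/
theorem stdAvg_avg_eq {G : Type*} [GaugeGroup G] {k : ℕ} (hk : k + 1 ≤ S.P.m + S.P.K) :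
    (stdAvg S.P G k).avg = axialAvg := by
  unfold stdAvg; rw [dif_pos hk]; rfl

variable {V : Type} [NormedAddCommGroup V] [NormedSpace ℂ V]

/-- **Bound55Std v3's RESIDUAL PAIR WAS FALSE** (regression guard): for `G = SU(2)`, the lane's standard external inputs (`ExternalInputs.ofStd`, any
minimizer data), any constants/series/pieces, any step `k` in the standing range with non-degenerate thresholds `0 ≤ ε₁(k)`, `4ε₁(k) < εS_k ≤ 4`,
`0 < ε₁(k+1)`, and the primitive regularity of the trivial-history data: the transported (49)-inequality at the trivial history WITH χB AT `εS`
(v3's `Fibre49 … (Hist.triv _)`) and `Fibre57Low` (R3D-02) cannot both hold. [folklore] -/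
theorem not_v3_pair_su2 (reg : ℕ → Set (GaugeField S.P 0 SU2)) (Uk : (k : ℕ) → GaugeField S.P (k + 1) SU2 → GaugeField S.P 0 SU2)
    (UkH : (k : ℕ) → Hist S.P k → GaugeField S.P k SU2 → GaugeField S.P 0 SU2)
    (UkH_triv : ∀ (k : ℕ) (W : GaugeField S.P k SU2), UkH k (Hist.triv S.P k) W = ukAll Uk k W)
    (K : CarrierConsts) (𝔖 : ∀ k, StepSeries S SU2 V (nblkOf S K k) k) (slot : ℕ → Prop) (k : ℕ)
    (P : StepPieces ((stdTowerInput (ExternalInputs.ofStd reg Uk UkH UkH_triv) K 𝔖).towerWith slot).toTowerRun k)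
    (hk : k + 1 ≤ S.P.m + S.P.K)
    (h0 : 0 ≤ eps1Of S K k) (h1 : 4 * eps1Of S K k < epsSOf S K k) (h2 : epsSOf S K k ≤ 4) (h3 : 0 < eps1Of S K (k + 1))
    (hU : Measurable ((stdTowerInput (ExternalInputs.ofStd reg Uk UkH UkH_triv) K 𝔖).UkH k (Hist.triv S.P k)))
    (hPm : Measurable ((stdTowerInput (ExternalInputs.ofStd reg Uk UkH UkH_triv) K 𝔖).Pint k (Hist.triv S.P k))) (cP : ℝ)
    (hPb : ∀ U, (stdTowerInput (ExternalInputs.ofStd reg Uk UkH UkH_triv) K 𝔖).Pint k (Hist.triv S.P k) U ≤ cP)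
    (h49 : (rnTransport ((ExternalInputs.ofStd reg Uk UkH UkH_triv).av k).avg (fun U =>
      stepWeight K.M₁ (rcolOf S K) (eps1Of S K) (epsSOf S K) k (Hist.triv S.P (k + 1)) U *
        chiB K.M₁ (rcolOf S K) (epsSOf S K) k (Hist.triv S.P (k + 1)) U *
        ((stdTowerInput (ExternalInputs.ofStd reg Uk UkH UkH_triv) K 𝔖).W.mass k (Hist.triv S.P (k + 1)).proj U *
          Real.exp (-(((stdTowerInput (ExternalInputs.ofStd reg Uk UkH UkH_triv) K 𝔖).towerWith slot).mainT k
              (Hist.triv S.P (k + 1)).proj U)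
            + (stdTowerInput (ExternalInputs.ofStd reg Uk UkH UkH_triv) K 𝔖).Pint k (Hist.triv S.P (k + 1)).proj U
            - ((stdTowerInput (ExternalInputs.ofStd reg Uk UkH UkH_triv) K 𝔖).towerWith slot).Ecst k
            + ((stdTowerInput (ExternalInputs.ofStd reg Uk UkH UkH_triv) K 𝔖).towerWith slot).Zterm k (Hist.triv S.P (k + 1)).proj
            + ((stdTowerInput (ExternalInputs.ofStd reg Uk UkH UkH_triv) K 𝔖).towerWith slot).Rm k))))
      ≤ᵐ[fieldMeasure S.P (k + 1) SU2] fun W =>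
        rnTransport ((ExternalInputs.ofStd reg Uk UkH UkH_triv).av k).avg (fun U =>
          stepWeight K.M₁ (rcolOf S K) (eps1Of S K) (epsSOf S K) k (Hist.triv S.P (k + 1)) U *
            (stdTowerInput (ExternalInputs.ofStd reg Uk UkH UkH_triv) K 𝔖).W.mass k (Hist.triv S.P (k + 1)).proj U) W *
        Real.exp (-(((stdTowerInput (ExternalInputs.ofStd reg Uk UkH UkH_triv) K 𝔖).towerWith slot).mainT (k + 1)
            (Hist.triv S.P (k + 1)) W)
          - ((stdTowerInput (ExternalInputs.ofStd reg Uk UkH UkH_triv) K 𝔖).towerWith slot).Ecst k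
          + (P.logσ₀ + P.dg * Real.log (S.gk k)) * P.starB (Hist.triv S.P (k + 1)) + P.logZU (Hist.triv S.P (k + 1)) W
          + P.Pold (Hist.triv S.P (k + 1)) W
          + ((stdTowerInput (ExternalInputs.ofStd reg Uk UkH UkH_triv) K 𝔖).towerWith slot).Zterm k (P.proj (Hist.triv S.P (k + 1)))
          + ((stdTowerInput (ExternalInputs.ofStd reg Uk UkH UkH_triv) K 𝔖).towerWith slot).Rm k
          + P.logFl (Hist.triv S.P (k + 1)) W))
    (h57 : Fibre57Low (ExternalInputs.ofStd reg Uk UkH UkH_triv) K 𝔖 slot k P) : False := by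
  have hclash := ae_small_of_transported_pair (ExternalInputs.ofStd reg Uk UkH UkH_triv) K 𝔖 slot k P (epsSOf S K)
    (by omega) (by linarith) hU hPm cP hPb h49 h57
  have havg : ((ExternalInputs.ofStd reg Uk UkH UkH_triv).av k).avg = (axialAvg : GaugeField S.P k SU2 → GaugeField S.P (k + 1) SU2) :=
    stdAvg_avg_eq (S := S) hk
  rw [havg] at hclash
  exact not_ae_small_su2 hk (by show 2 ≤ 3; norm_num) h0 h1 h2 h3 hclash

/-- **v4 PASSES THE MECHANISM** (the lead's STEP-5 item (b)(ii)): with χB at `ε₁` the clash lemma applied to v4's `Fibre49 … (Hist.triv _)`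
and `Fibre57Low` yields only the TAUTOLOGY «ε₁-small ⇒ … ⇒ ε₁-small»: this mechanism derives no constraint — in particular no contradiction
— from the repaired pair (any gauge group, any data). [folklore] -/
theorem v4_pair_mechanism_trivial {G : Type} [GaugeGroup G] [MeasurableSpace G] [HaarData G] [RegularGaugeGroup G]
    (X : ExternalInputs S G) (K : CarrierConsts) (𝔖 : ∀ k, StepSeries S G V (nblkOf S K k) k) (slot : ℕ → Prop) (k : ℕ)
    (P : StepPieces ((stdTowerInput X K 𝔖).towerWith slot).toTowerRun k) (hk : k ≤ S.P.m + S.P.K)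
    (hU : Measurable ((stdTowerInput X K 𝔖).UkH k (Hist.triv S.P k)))
    (hPm : Measurable ((stdTowerInput X K 𝔖).Pint k (Hist.triv S.P k))) (cP : ℝ)
    (hPb : ∀ U : GaugeField S.P k G, (stdTowerInput X K 𝔖).Pint k (Hist.triv S.P k) U ≤ cP)
    (h49 : Fibre49 X K 𝔖 slot k P (Hist.triv S.P (k + 1))) (h57 : Fibre57Low X K 𝔖 slot k P) :
    ∀ᵐ U ∂(fieldMeasure S.P k G), PlaqSmall (eps1Of S K k) U →
      PlaqSmall (eps1Of S K (k + 1)) ((X.av k).avg U) → PlaqSmall (eps1Of S K k) U :=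
  ae_small_of_transported_pair X K 𝔖 slot k P (eps1Of S K) hk le_rfl hU hPm cP hPb ((fibre49_triv_iff X K 𝔖 slot k P).mp h49) h57

end Lane

end Summit.QuantumFields.Balaban3D.Proofs.FibreClashWitness

end
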